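import Summits.BirchSwinnertonDyer.BirchSwinnertonDyer.Theorems.GenusKolyvaginAtTwoPowDvdShaCardAtTwoRTAuxiliaryClass
import Summits.BirchSwinnertonDyer.Rank1Residual.X11b.BDPRouteSelmerLevelBound
import HarnessLib

/-!
# Route `GenusKolyvaginAtTwo`, LINES 18/19 (L_T stmt-BirchSwinnertonDyer-23242, L⁺_T stmt-23379), step (b) input I5, part 3:
# McCALLUM'S AUXILIARY CLASS AT `p = 2`, INVARIANT UNDER AN INVOLUTION — the `p = 2` substitute for the stipulation
# «`c ∈ H¹(K, E_{p^M})^±`» of McCallum 1991 §5 (p. 308)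

Width seat `bsd-line-gk2-p4` g16 (cell `bsd-f1-sign2`), `--supports stmt-BirchSwinnertonDyer-23242` (helper; closes nothing).
THEOREMS ONLY: no definition, no named fact, no `sorry`; standard axioms.  BSD is NOT proved by any of this.
Sequel of `…RTAuxiliaryClassCount.lean` (p687763) and `…RTAuxiliaryClass.lean` (McCallum Prop. 2.1, unconditional over a
totally complex `K`).

WHY.  McCallum's proof of Prop. 5.2 [McCallumLMS1991, p. 308 = held `book:editornd-l-functions-arithmetic` p0286] needs the
auxiliary class of Prop. 2.1 IN AN EIGENSPACE of complex conjugation `τ`: «in the proof of Proposition 2.1, we can add the further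
stipulation that `c ∈ H¹(K, E_{p^M})^±`» — at odd `p` because the solution group `V` splits as `V⁺ ⊕ V⁻`.  At `p = 2` there is no
splitting, but the LINE 6/13/18/19 files replace eigenclasses by `τ`-INVARIANT classes, which descend to `ℚ` (gk2-p3
`EigenClassesFinite.existsUnique_resTorsion_eq_of_conjAct_eq`).  The `p = 2` substitute is elementary: the solution group
`V = {c ∈ H¹_{𝓛, ⊤ on S∪{w}}(K, E[2^k]) : loc_v c ∈ H_v (v ∈ S)}` is a finite `2`-group, non-trivial by Prop. 2.1, so ANY additive
involution `σ` of `H¹(K, E[2^k])` stabilising `V` (for `σ = conjAct W τ`: a `τ`-stable datum `(S, w, (H_v))`) fixes a non-zero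
element of `V` (part 1's `exists_ne_zero_fixed_of_involutive`: the non-fixed elements pair off).  Since `V` is a subgroup, `σ`-
and `(−σ)`-stability coincide, so the same `V` carries non-zero fixed classes for BOTH signs (`E`-side and `E^{(d)}`-side descents).

WHAT (namespace `…Theorems.GenusExact.AuxiliaryClass`).
* §1 (pure algebra) `exists_natCard_eq_two_pow_of_nsmul_eq_zero` (a finite abelian group killed by `2^k` has order `2^m`,
  Cauchy), `exists_ne_zero_fixed_mem_of_involutive` (a `σ`-stable subgroup killed by `2^k` with a non-zero element has a non-zero
  `σ`-fixed element).
* §2 **`exists_ne_zero_fixed_mem_kummerOutside`** — Prop. 2.1 at level `2^k` WITH `σ c = c`, over the displayed inputs;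
  **`exists_ne_zero_fixed_selmerLocalKer`** — the same UNCONDITIONAL (tree theorems `poitouTate_selmerStructure_duality_holds`,
  `localEulerPoincareCharacteristic_holds`), in `selmerLocalKer` currency, hypothesis at `w` in the printed form `E(K_w)[2^k] ≠ 0`.

HONEST FRAMING: `K` totally complex; the `σ`-stability of the datum is a HYPOTHESIS (for Kolyvagin data: `w`, `S` above inert
primes and `H_v = im χ_ℓ` are `τ`-stable — the consumer's bookkeeping); closes nothing.  BSD is NOT proved by any of this.

References: [McCallumLMS1991] §2 Prop. 2.1 (p. 300), §5 p. 308; [GrossLMS1991] §5 (5.1); [MilneADT2006] Ch. I Thm. 4.10(b).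
-/

set_option autoImplicit false
-- the Theorems namespace of this sub repeats the summit name by design (D-0017 nested layout)
set_option linter.dupNamespace false

noncomputable section

open scoped Classical

open CategoryTheory Field NumberField IsDedekindDomain Function
open Literature.NumberTheory.EllipticCurves
open Literature.NumberTheory.GaloisRepresentations
open Literature.NumberTheory.GaloisCohomology
open Summit.BirchSwinnertonDyer.Rank1Residual.X11b.KummerPT
open Summit.BirchSwinnertonDyer.Rank1Residual.X11b.SelmerLevelBound
open scoped ContRepresentation

namespace Summit.BirchSwinnertonDyer.BirchSwinnertonDyer.Theorems.GenusExact.AuxiliaryClass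

/-! ## §1 Finite `2`-groups and involutions -/

section TwoGroup

/-- A finite abelian group killed by `2^k` has order a power of `2` (Cauchy: an odd prime divisor of the order would give an
element of odd prime order). [folklore] -/
theorem exists_natCard_eq_two_pow_of_nsmul_eq_zero {V : Type*} [AddCommGroup V] [Finite V] {k : ℕ}
    (hV : ∀ v : V, 2 ^ k • v = 0) : ∃ m : ℕ, Nat.card V = 2 ^ m := by
  classical
  haveI := Fintype.ofFinite V
  refine ⟨_, Nat.eq_prime_pow_of_unique_prime_dvd Nat.card_pos.ne' (fun {d} hd hdvd ↦ ?_)⟩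
  haveI : Fact d.Prime := ⟨hd⟩
  rw [Nat.card_eq_fintype_card] at hdvd
  obtain ⟨v, hv⟩ := exists_prime_addOrderOf_dvd_card d hdvd
  have hdk : d ∣ 2 ^ k := by
    rw [← hv]
    exact addOrderOf_dvd_of_nsmul_eq_zero (hV v)
  exact (Nat.prime_dvd_prime_iff_eq hd Nat.prime_two).mp (hd.dvd_of_dvd_pow hdk)

/-- **A `σ`-stable subgroup killed by `2^k` with a non-zero element has a NON-ZERO `σ`-FIXED element**, for any additive
involution `σ` of the ambient group (restrict `σ` to the subgroup, a finite `2`-group of order `> 1`, and use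
`exists_ne_zero_fixed_of_involutive`). [cite: McCallumLMS1991, §5 (p. 308)] -/
theorem exists_ne_zero_fixed_mem_of_involutive {A : Type*} [AddCommGroup A] (V : AddSubgroup A) [Finite V] {k : ℕ}
    (hV : ∀ v ∈ V, 2 ^ k • v = 0) (hne : ∃ v ∈ V, v ≠ 0) (σ : A →+ A) (hσ : Function.Involutive σ)
    (hstab : ∀ v ∈ V, σ v ∈ V) : ∃ v ∈ V, v ≠ 0 ∧ σ v = v := by
  -- the restriction of `σ` to `V`
  set σV : V →+ V := (σ.comp V.subtype).codRestrict V (fun v ↦ hstab v v.2) with hσV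
  have hσV_apply : ∀ v : V, ((σV v : V) : A) = σ v := fun v ↦ rfl
  have hσV_inv : Function.Involutive σV := fun v ↦ Subtype.ext (by
    rw [hσV_apply, hσV_apply]; exact hσ v)
  obtain ⟨m, hm⟩ := exists_natCard_eq_two_pow_of_nsmul_eq_zero (V := V) (k := k) (fun v ↦ Subtype.ext (by
    rw [AddSubgroup.coe_nsmul, AddSubgroup.coe_zero]; exact hV v v.2))
  have hmpos : 0 < m := by
    by_contra h0
    have hm1 : Nat.card V = 1 := by rw [hm, Nat.le_zero.mp (not_lt.mp h0), pow_zero]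
    obtain ⟨v, hv, hv0⟩ := hne
    haveI := (Nat.card_eq_one_iff_unique.mp hm1).1
    exact hv0 (congrArg Subtype.val (Subsingleton.elim (⟨v, hv⟩ : V) 0))
  obtain ⟨v, hv0, hvfix⟩ := exists_ne_zero_fixed_of_involutive σV hσV_inv hmpos hm
  refine ⟨v, v.2, fun h ↦ hv0 (Subtype.ext h), ?_⟩
  rw [← hσV_apply, hvfix]

end TwoGroup

/-! ## §2 The `σ`-invariant auxiliary class at `p = 2` -/

section Kummer

variable {K : Type} [Field K] [NumberField K] (W : WeierstrassCurve K) [W.IsElliptic] (k : ℕ)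

variable (e : W.geomTorsion ((2 ^ k : ℕ) : ℤ) → W.geomTorsion ((2 ^ k : ℕ) : ℤ) → AlgebraicClosure K)
  (hμ : ∀ S T, e S T ^ (2 ^ k) = 1)
  (hadd₁ : ∀ S₁ S₂ T, e (S₁ + S₂) T = e S₁ T * e S₂ T)
  (hadd₂ : ∀ S T₁ T₂, e S (T₁ + T₂) = e S T₁ * e S T₂)
  (hgal : ∀ (σ : absoluteGaloisGroup K) (S T : W.geomTorsion ((2 ^ k : ℕ) : ℤ)),
    σ • e S T = e (σ • S) (σ • T))
  (halt : ∀ T, e T T = 1) (hnondeg : ∀ T, (∀ S, e S T = 1) → T = 0)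

omit [NumberField K] [W.IsElliptic] in
/-- Every class of `H¹(K, E[n])` is killed by `n`. [folklore] -/
theorem nsmul_galH1Torsion_eq_zero (n : ℕ) (c : W.galH1Torsion (n : ℤ)) : n • c = 0 :=
  nsmul_continuousCohomology_one_eq_zero _ n (fun T : W.geomTorsion (n : ℤ) ↦ AddSubgroup.torsionBy.nsmul T) c

include e hμ hadd₁ hadd₂ hgal halt hnondeg in
/-- **McCallum's auxiliary class at `p = 2`, FIXED by a stabilising involution** (over the displayed analytic inputs): in the
setting of `exists_ne_zero_mem_kummerOutside` at level `2^k`, if an additive involution `σ` of `H¹(K, E[2^k])` maps the solution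
group `V = {c ∈ kummerOutside W (2^k) (S ∪ {w}) : loc_v c ∈ H_v (v ∈ S)}` into itself, then `V` contains a NON-ZERO class with
`σ c = c` (Prop. 2.1 gives `V ≠ 0`; `V` is a finite `2`-group; `exists_ne_zero_fixed_mem_of_involutive`).
[cite: McCallumLMS1991, §2 Prop. 2.1 and §5 (p. 308)] -/
theorem exists_ne_zero_fixed_mem_kummerOutside (hK : ∀ w : InfinitePlace K, w.IsComplex)
    {inv : LocalInvariants K (2 ^ k)} (hperf : inv.IsPerfect) (hsum : inv.SumLocalTermEqZero)
    (hcompl : inv.SelmerComplement)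
    (hEuler : ∀ v : HeightOneSpectrum (𝓞 K),
      Nat.card (galoisCohomology ((W.torsionGaloisModule ((2 ^ k : ℕ) : ℤ)).toLocal (Sum.inr v)) 1) =
        (Nat.card (nsmulAddMonoidHom (2 ^ k) :
            (W.baseChange (v.adicCompletion K)).toAffine.Point →+ _).ker *
          Nat.card (v.adicCompletionIntegers K ⧸
            Ideal.span {((2 ^ k : ℕ) : v.adicCompletionIntegers K)})) ^ 2)
    (S : Finset (HeightOneSpectrum (𝓞 K))) (w : HeightOneSpectrum (𝓞 K)) (hwS : w ∉ S)
    (hw : 1 < Nat.card (galoisCohomology ((W.torsionGaloisModule ((2 ^ k : ℕ) : ℤ)).toLocal (Sum.inr w)) 1))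
    (H : ∀ v : HeightOneSpectrum (𝓞 K),
      AddSubgroup (galoisCohomology ((W.torsionGaloisModule ((2 ^ k : ℕ) : ℤ)).toLocal (Sum.inr v)) 1))
    (hH : ∀ v ∈ S, Nat.card (H v) ^ 2 =
      Nat.card (galoisCohomology ((W.torsionGaloisModule ((2 ^ k : ℕ) : ℤ)).toLocal (Sum.inr v)) 1))
    (σ : W.galH1Torsion ((2 ^ k : ℕ) : ℤ) →+ W.galH1Torsion ((2 ^ k : ℕ) : ℤ)) (hσ : Function.Involutive σ)
    (hstab : ∀ c ∈ kummerOutside W (2 ^ k) ((insert w S).map Function.Embedding.inr),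
      (∀ v ∈ S, galoisCohomology.localization (W.torsionGaloisModule ((2 ^ k : ℕ) : ℤ)) (Sum.inr v) 1 c ∈ H v) →
        σ c ∈ kummerOutside W (2 ^ k) ((insert w S).map Function.Embedding.inr) ∧
          ∀ v ∈ S, galoisCohomology.localization (W.torsionGaloisModule ((2 ^ k : ℕ) : ℤ)) (Sum.inr v) 1 (σ c) ∈ H v) :
    ∃ c ∈ kummerOutside W (2 ^ k) ((insert w S).map Function.Embedding.inr), c ≠ 0 ∧ σ c = c ∧
      ∀ v ∈ S, galoisCohomology.localization (W.torsionGaloisModule ((2 ^ k : ℕ) : ℤ)) (Sum.inr v) 1 c ∈ H v := by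
  classical
  -- the solution group `V`
  obtain ⟨V, hV⟩ : ∃ V : AddSubgroup (W.galH1Torsion ((2 ^ k : ℕ) : ℤ)),
      V = kummerOutside W (2 ^ k) ((insert w S).map Function.Embedding.inr) ⊓
        ⨅ v ∈ S, (H v).comap (galoisCohomology.localization (W.torsionGaloisModule ((2 ^ k : ℕ) : ℤ)) (Sum.inr v) 1) :=
    ⟨_, rfl⟩
  have hmemV : ∀ c, c ∈ V ↔ c ∈ kummerOutside W (2 ^ k) ((insert w S).map Function.Embedding.inr) ∧
      ∀ v ∈ S, galoisCohomology.localization (W.torsionGaloisModule ((2 ^ k : ℕ) : ℤ)) (Sum.inr v) 1 c ∈ H v := by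
    intro c
    subst hV
    exact ⟨fun h ↦ ⟨h.1, fun v hv ↦ AddSubgroup.mem_iInf.mp (AddSubgroup.mem_iInf.mp h.2 v) hv⟩,
      fun h ↦ ⟨h.1, AddSubgroup.mem_iInf.mpr fun v ↦ AddSubgroup.mem_iInf.mpr fun hv ↦ h.2 v hv⟩⟩
  have hfinKO : Finite (kummerOutside W (2 ^ k) ((insert w S).map Function.Embedding.inr)) :=
    finite_kummerOutside W (2 ^ k) _
  have hle : V ≤ kummerOutside W (2 ^ k) ((insert w S).map Function.Embedding.inr) := fun c hc ↦ ((hmemV c).mp hc).1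
  haveI : Finite V :=
    @Finite.of_injective _ _ hfinKO (AddSubgroup.inclusion hle) (AddSubgroup.inclusion_injective hle)
  obtain ⟨c₀, hc₀, hc₀0, hc₀H⟩ := exists_ne_zero_mem_kummerOutside W 2 k e hμ hadd₁ hadd₂ hgal halt hnondeg hK hperf hsum
    hcompl hEuler S w hwS hw H hH
  obtain ⟨c, hcV, hc0, hcfix⟩ := exists_ne_zero_fixed_mem_of_involutive V (k := k)
    (fun c _ ↦ nsmul_galH1Torsion_eq_zero W (2 ^ k) c) ⟨c₀, (hmemV c₀).mpr ⟨hc₀, hc₀H⟩, hc₀0⟩ σ hσ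
    (fun c hc ↦ (hmemV (σ c)).mpr (hstab c ((hmemV c).mp hc).1 ((hmemV c).mp hc).2))
  exact ⟨c, ((hmemV c).mp hcV).1, hc0, hcfix, ((hmemV c).mp hcV).2⟩

/-- **McCallum's auxiliary class at `p = 2`, fixed by a stabilising involution — UNCONDITIONAL**, in `selmerLocalKer` currency,
with the hypothesis at `w` in the printed form `E(K_w)[2^k] ≠ 0`: for `E = W` elliptic over a totally complex number field `K`,
`k ≥ 1`, `S` a finite set of finite places, `w ∉ S` finite with `1 < #E(K_w)[2^k]`, half-size `H_v` (`v ∈ S`), and an additive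
involution `σ` of `H¹(K, E[2^k])` stabilising the solution group (e.g. `σ = conjAct W τ (2^k)` on a `τ`-stable datum): there is
`c : galH1Torsion W (2^k)` with `c ≠ 0`, `σ c = c`, `loc_v c ∈ H_v` on `S`, `c ∈ selmerLocalKer W K_v (2^k)` at every finite
`v ∉ S ∪ {w}` and at every infinite place.  (Named facts discharged by `poitouTate_selmerStructure_duality_holds` and
`localEulerPoincareCharacteristic_holds`; Weil pairing by `exists_weilPairing_holds`.) [cite: McCallumLMS1991, §2 Prop. 2.1 and §5 (p. 308)]
[cite: MilneADT2006, Ch. I, Thm. 2.8 and Thm. 4.10(b)] -/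
theorem exists_ne_zero_fixed_selmerLocalKer (hK : ∀ w : InfinitePlace K, w.IsComplex) (hk : 0 < k)
    (S : Finset (HeightOneSpectrum (𝓞 K))) (w : HeightOneSpectrum (𝓞 K)) (hwS : w ∉ S)
    (htor : 1 < Nat.card (nsmulAddMonoidHom (2 ^ k) :
        (W.baseChange (w.adicCompletion K)).toAffine.Point →+ _).ker)
    (H : ∀ v : HeightOneSpectrum (𝓞 K),
      AddSubgroup (galoisCohomology ((W.torsionGaloisModule ((2 ^ k : ℕ) : ℤ)).toLocal (Sum.inr v)) 1))
    (hH : ∀ v ∈ S, Nat.card (H v) ^ 2 =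
      Nat.card (galoisCohomology ((W.torsionGaloisModule ((2 ^ k : ℕ) : ℤ)).toLocal (Sum.inr v)) 1))
    (σ : W.galH1Torsion ((2 ^ k : ℕ) : ℤ) →+ W.galH1Torsion ((2 ^ k : ℕ) : ℤ)) (hσ : Function.Involutive σ)
    (hstab : ∀ c ∈ kummerOutside W (2 ^ k) ((insert w S).map Function.Embedding.inr),
      (∀ v ∈ S, galoisCohomology.localization (W.torsionGaloisModule ((2 ^ k : ℕ) : ℤ)) (Sum.inr v) 1 c ∈ H v) →
        σ c ∈ kummerOutside W (2 ^ k) ((insert w S).map Function.Embedding.inr) ∧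
          ∀ v ∈ S, galoisCohomology.localization (W.torsionGaloisModule ((2 ^ k : ℕ) : ℤ)) (Sum.inr v) 1 (σ c) ∈ H v) :
    ∃ c : W.galH1Torsion ((2 ^ k : ℕ) : ℤ), c ≠ 0 ∧ σ c = c ∧
      (∀ v ∈ S, galoisCohomology.localization (W.torsionGaloisModule ((2 ^ k : ℕ) : ℤ)) (Sum.inr v) 1 c ∈ H v) ∧
      (∀ v : HeightOneSpectrum (𝓞 K), v ∉ S → v ≠ w →
        c ∈ W.selmerLocalKer (v.adicCompletion K) ((2 ^ k : ℕ) : ℤ)) ∧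
      (∀ w' : InfinitePlace K, c ∈ W.selmerLocalKer w'.Completion ((2 ^ k : ℕ) : ℤ)) := by
  have hpp : IsPrimePow (2 ^ k) := ⟨2, k, Nat.prime_two.prime, hk, rfl⟩
  have hp2 : 2 ≤ 2 ^ k := le_trans (le_refl 2) (Nat.le_self_pow hk.ne' 2)
  have hchar : ((2 ^ k : ℕ) : K) ≠ 0 := Nat.cast_ne_zero.mpr (pow_ne_zero _ two_ne_zero)
  obtain ⟨e, hμ, hadd₁, hadd₂, halt, hnondeg, hgal⟩ := W.exists_weilPairing_holds (2 ^ k) hp2 hchar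
  obtain ⟨inv, hperf, hsum, -, hcompl⟩ :=
    Summit.BirchSwinnertonDyer.BirchSwinnertonDyer.Theorems.SchneiderFreeAdditiveX3.PoitouTateReduction.poitouTate_selmerStructure_duality_holds
      K (2 ^ k)
  have hEuler : ∀ v : HeightOneSpectrum (𝓞 K),
      Nat.card (galoisCohomology ((W.torsionGaloisModule ((2 ^ k : ℕ) : ℤ)).toLocal (Sum.inr v)) 1) =
        (Nat.card (nsmulAddMonoidHom (2 ^ k) :
            (W.baseChange (v.adicCompletion K)).toAffine.Point →+ _).ker *
          Nat.card (v.adicCompletionIntegers K ⧸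
            Ideal.span {((2 ^ k : ℕ) : v.adicCompletionIntegers K)})) ^ 2 := fun v ↦ by
    haveI : CharZero (v.adicCompletion K) := charZero_adicCompletion v
    exact natCard_galoisCohomology_one_torsion_adicCompletion_eq_sq W v (2 ^ k) hpp
      (localEulerPoincareCharacteristic_holds (v.adicCompletion K))
  have hw := one_lt_natCard_localH1_of_torsion W 2 k w (hEuler w) htor
  obtain ⟨c, hc, hc0, hcfix, hcH⟩ := exists_ne_zero_fixed_mem_kummerOutside W k e hμ hadd₁ hadd₂ hgal halt hnondeg hK
    hperf hsum hcompl hEuler S w hwS hw H hH σ hσ hstab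
  have hc' := (mem_kummerOutside_iff W (2 ^ k) _ c).mp hc
  have key : ∀ v : Place K, v ∉ (insert w S).map Function.Embedding.inr →
      c ∈ W.selmerLocalKer (Place.Completion v) ((2 ^ k : ℕ) : ℤ) := by
    intro v hv
    rw [← W.comap_localization_kummerSelmerStructure ((2 ^ k : ℕ) : ℤ) v]
    exact hc' v hv
  refine ⟨c, hc0, hcfix, hcH, fun v hvS hvw ↦ ?_, fun w' ↦ ?_⟩
  · rw [← W.selmerLocalKer_completion_inr]
    refine key (Sum.inr v) fun h ↦ ?_
    rw [Finset.mem_map] at h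
    obtain ⟨u, hu, huv⟩ := h
    have huv' : u = v := Sum.inr_injective huv
    subst huv'
    rcases Finset.mem_insert.mp hu with h | h
    · exact hvw h
    · exact hvS h
  · rw [← W.selmerLocalKer_completion_inl]
    refine key (Sum.inl w') fun h ↦ ?_
    rw [Finset.mem_map] at h
    obtain ⟨u, -, huv⟩ := h
    exact Sum.inr_ne_inl huv

end Kummer

end Summit.BirchSwinnertonDyer.BirchSwinnertonDyer.Theorems.GenusExact.AuxiliaryClass

end
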